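/-
Copyright: ideator seat ym-r3-idea-2 (gen 9), cell ym3-torus.  Third BC5 / tribunal-T3 WITNESS RUNG for the shared deciding crux
`RectangleTailL` (stmt-QuantumFields-23864) of the line-routes `RectangleDomination` (LINE 17) and `RandomisedStokes` (LINE 18):
ALL rectangles of bounded size `a, b ≤ R` (the finite-range truncation of the crux), via the full lattice non-abelian Stokes bound.
Nothing is claimed beyond what the kernel checks below; no summit, rung of the ladder or crux is proved here.
-/
import Summits.QuantumFields.YangMills.Theorems.RectangleDominationRectangleTailLStripRung

/-!
# `RectangleTailL` — the bounded-rectangle rung `a, b ≤ R` (BC5 witness no. 3) and the lattice Stokes bound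

§1 completes the deterministic LATTICE NON-ABELIAN STOKES BOUND on Bałaban's finest torus: growing the rectangle
`[x, x+a e_μ] × [x, x+b e_ν]` by one column multiplies its corner-based holonomy ON THE LEFT by the corner-transported strip,
`hol ∂((a+1)×b) = (A_a · hol ∂_{x+a e_μ}(1×b) · A_a⁻¹) · hol ∂(a×b)`, `A_a = hol(x → x+a e_μ)` (`pathHol_rectLoop_succ_left`), whence with
the strip recurrence of `RectangleDominationRectangleTailLStripRung`
`dist1(hol ∂(a×b)) ≤ Σ_{i<a} Σ_{k<b} dist1(U(∂p_{ik}))` (`dist1_pathHol_rectLoop_le_sum`) — the rectangle's deviation from `1` is at most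
the sum of the deviations of its `ab` plaquette variables (B7 (19): `|gh−1| ≤ |g−1|+|h−1|`, `|hgh⁻¹−1| = |g−1|`).  This is the `i = 0`,
un-averaged instance of the telescoping behind `ShallowRectangleDominationL` (LINE 17, item 23865) and is reusable there.
§2: union bound + the tree's Peierls–chessboard single-plaquette tail at threshold `t/(ab)` ⇒ the body of `RectangleTailL` VERBATIM with
`1 ≤ a → 1 ≤ b` strengthened to `1 ≤ a → a ≤ R → 1 ≤ b → b ≤ R`, constants `α = 1`, `c = 1/(4R⁴)`, `C = 2e^{24}c₀⁻³`, `A = 5`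
(`rectangleTailL_rung_bounded`); `R = 1` is the `1 × 1` rung, `a = 1` the strip rung (with a weaker `c`).

WHY THIS IS A WITNESS AND NOT THE CRUX: the union bound yields the AREA-type exponent `β t²/(4a²b²)`, matched to the crux's
PERIMETER·log exponent `β t²/((a+b)(1+log(a+b)))` only for bounded `a, b ≤ R` (`c = 1/(4R⁴)`); uniformly in the size the `a²b² ↝ (a+b)log(a+b)`
gap is exactly the multi-scale decorrelation content of the open crux (not in print for non-abelian `d = 3`; locator note LIT-LINE6).

References: [FrohlichIsraelLiebSimon1978] Thm 4.1; [Balaban1985UV3] (11) p.258, (71) p.273; [Balaban1985Averaging] (9), (19); [ChatterjeeYMProb2019] §4.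
-/

noncomputable section

open MeasureTheory
open Literature.MathematicalPhysics.QuantumFieldTheory.Balaban1983to89
open Literature.MathematicalPhysics.QuantumFieldTheory.Balaban1983to89.T3ContinuumYM3Torus
open Literature.MathematicalPhysics.QuantumFieldTheory.Balaban1983to89.T3UnitScaleTilt
open Literature.MathematicalPhysics.QuantumFieldTheory.Balaban1983to89.T3UnitLawDensityEML
open Literature.MathematicalPhysics.QuantumFieldTheory.Balaban1983to89.Missing
open Summit.QuantumFields.YangMills.Theorems
open Summit.QuantumFields.YangMills.Theorems.RectangleDominationRectangleTailLStripRung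

namespace Summit.QuantumFields.YangMills.Theorems.RectangleDominationRectangleTailLBoundedRung

/-! ## 1. Lattice non-abelian Stokes: the recurrence in `a` and the double-sum bound -/

section Loop

variable {P : Params} {G : Type*} [GaugeGroup G]

/-- **COLUMN RECURRENCE.**  `hol ∂((a+1)×b) = (A_a · hol ∂_{x+a e_μ}(1×b) · A_a⁻¹) · hol ∂(a×b)` with `A_a = hol(x → x + a e_μ)`:
adding the column `[x+a e_μ, x+(a+1)e_μ] × [x, x+b e_ν]` multiplies the corner-based holonomy on the LEFT by the transported strip
(lattice non-abelian Stokes, one column at a time). [cite: Balaban1985Averaging, (9) p.19] -/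
theorem pathHol_rectLoop_succ_left (U : GaugeField P 0 G) (x : Site P 0) (μ ν : Fin P.d) (a b : ℕ) :
    pathHol U (rectLoop x μ ν (a + 1) b) =
      (pathHol U (fwdSeg x μ a) * pathHol U (rectLoop (x.move μ a) μ ν 1 b) * (pathHol U (fwdSeg x μ a))⁻¹) *
        pathHol U (rectLoop x μ ν a b) := by
  have h1 : x.move μ (a + 1) = (x.move μ a).shift μ := Site.move_succ x μ a
  have hc : (x.move ν b).move μ a = (x.move μ a).move ν b := Site.move_comm x ν μ b a
  simp only [rectLoop, fwdSeg, bwdSeg, Site.move_zero, Site.move_one, h1, hc, List.nil_append, List.append_assoc,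
    List.cons_append, pathHol_append, pathHol_cons, pathHol_bwdSeg_eq_inv, Bool.false_eq_true, if_true, if_false]
  group

/-- **LATTICE STOKES BOUND `dist1(hol ∂(a×b)) ≤ Σ_{i<a} Σ_{k<b} dist1(cell_{ik})`** (cells `U(y,μ)U(y+e_μ,ν)U(y+e_ν,μ)⁻¹U(y,ν)⁻¹` at
`y = x + i e_μ + k e_ν`): column recurrence + conjugation invariance + the strip bound; `a = 0` is the degenerate loop
`hol(x → x+b e_ν) hol(x → x+b e_ν)⁻¹ = 1`. [cite: Balaban1985Averaging, (19) p.21] -/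
theorem dist1_pathHol_rectLoop_le_sum (U : GaugeField P 0 G) (x : Site P 0) (μ ν : Fin P.d) (b : ℕ) :
    ∀ a : ℕ, dist1 (pathHol U (rectLoop x μ ν a b)) ≤ ∑ i ∈ Finset.range a, ∑ k ∈ Finset.range b,
      dist1 (U ⟨(x.move μ i).move ν k, μ⟩ * U ⟨((x.move μ i).move ν k).shift μ, ν⟩ *
        (U ⟨((x.move μ i).move ν k).shift ν, μ⟩)⁻¹ * (U ⟨(x.move μ i).move ν k, ν⟩)⁻¹)
  | 0 => by
    simp [rectLoop, fwdSeg, bwdSeg, pathHol_append, pathHol_bwdSeg_eq_inv, GaugeGroup.dist1_one]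
  | a + 1 => by
    rw [pathHol_rectLoop_succ_left, Finset.sum_range_succ, add_comm]
    refine (GaugeGroup.dist1_mul_le _ _).trans (add_le_add ?_ (dist1_pathHol_rectLoop_le_sum U x μ ν b a))
    rw [GaugeGroup.dist1_conj]
    exact dist1_pathHol_rectLoop_one_le_sum U (x.move μ a) μ ν b

/-- **The rectangle tail event lies in a union of `ab` single-plaquette tail events at threshold `t/(ab)`** (`a, b ≥ 1`). [folklore] -/
theorem setOf_rectLoop_subset (x : Site P 0) {μ ν : Fin P.d} (hμν : μ ≠ ν) {a b : ℕ} (ha : 1 ≤ a) (hb : 1 ≤ b) (t : ℝ) :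
    ∃ p : ℕ × ℕ → Plaq P 0, {U : GaugeField P 0 G | t ≤ dist1 (pathHol U (rectLoop x μ ν a b))} ⊆
      ⋃ ik ∈ Finset.range a ×ˢ Finset.range b, {U | t / (a * b) ≤ dist1 (GaugeField.plaqHol U (p ik))} := by
  choose p hp using fun ik : ℕ × ℕ => exists_plaq_dist1_cell (G := G) ((x.move μ ik.1).move ν ik.2) hμν
  refine ⟨p, fun U hU => ?_⟩
  simp only [Set.mem_setOf_eq] at hU
  simp only [Set.mem_iUnion, Set.mem_setOf_eq, exists_prop]
  by_contra hall
  push Not at hall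
  have ha0 : (0 : ℝ) < a := by exact_mod_cast ha
  have hb0 : (0 : ℝ) < b := by exact_mod_cast hb
  have hne : (Finset.range a ×ˢ Finset.range b).Nonempty :=
    ⟨(0, 0), Finset.mem_product.2 ⟨Finset.mem_range.2 ha, Finset.mem_range.2 hb⟩⟩
  have hlt : ∑ ik ∈ Finset.range a ×ˢ Finset.range b, dist1 (GaugeField.plaqHol U (p ik)) <
      ∑ _ik ∈ Finset.range a ×ˢ Finset.range b, t / (a * b) :=
    Finset.sum_lt_sum_of_nonempty hne fun ik hik => hall ik hik
  rw [Finset.sum_const, Finset.card_product, Finset.card_range, Finset.card_range, nsmul_eq_mul, Nat.cast_mul,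
    mul_div_cancel₀ _ (mul_pos ha0 hb0).ne'] at hlt
  have hle := dist1_pathHol_rectLoop_le_sum U x μ ν b a
  rw [← Finset.sum_product (s := Finset.range a) (t := Finset.range b)
    (f := fun ik : ℕ × ℕ => dist1 (U ⟨(x.move μ ik.1).move ν ik.2, μ⟩ * U ⟨((x.move μ ik.1).move ν ik.2).shift μ, ν⟩ *
        (U ⟨((x.move μ ik.1).move ν ik.2).shift ν, μ⟩)⁻¹ * (U ⟨(x.move μ ik.1).move ν ik.2, ν⟩)⁻¹))] at hle
  simp only [hp] at hle
  linarith

end Loop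

/-! ## 2. The rung -/

/-- **`RectangleTailL` ON BOUNDED RECTANGLES `a, b ≤ R` (BC5 witness no. 3).**  The body of `Theses.RectangleDomination.RectangleTailL`
with `1 ≤ a → 1 ≤ b` strengthened to `1 ≤ a → a ≤ R → 1 ≤ b → b ≤ R`, constants `α = 1`, `c = 1/(4R⁴)`, `C = 2e^{24}c₀⁻³`, `A = 5`:
`Gibbs_K{t ≤ dist1(hol ∂rect_{a×b})} ≤ C β_K^5 (a+b)^5 exp(−c t² β_K/((a+b)(1+log(a+b))))` for every `T3Family F`, `0 < γ ≤ 1`, run `K`,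
corner, directions `μ ≠ ν`, `1 ≤ a, b ≤ R`, `0 < t ≤ 1`.  Lattice Stokes bound (§1) + union bound + chessboard single-plaquette tail at
`t/(ab)` + `β_K ≥ 1`; uniform in the volume and the cut-off, NOT in `R`. [cite: FrohlichIsraelLiebSimon1978, Thm. 4.1; Balaban1985UV3, (11) p.258 and (71) p.273] -/
theorem rectangleTailL_rung_bounded : ∀ (L R : ℕ), 1 ≤ R → ∃ (α c C : ℝ) (A : ℕ), 0 < α ∧ 0 < c ∧ 0 ≤ C ∧
    ∀ (F : T3Family) (γ : ℝ), F.L = L → 0 < γ → γ ≤ 1 →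
      ∀ (K a b : ℕ) (x : Site (F.P K) 0) (μ ν : Fin (F.P K).d) (t : ℝ), μ ≠ ν → 1 ≤ a → a ≤ R → 1 ≤ b → b ≤ R →
        2 * (a + b) < (F.P K).sitesPerDir 0 → 0 < t → t ≤ 1 →
          (gibbsK F ℰp γ K).real {U | t ≤ dist1 (pathHol U (rectLoop x μ ν a b))} ≤
            C * (F.scheme ℰp γ).β K ^ A * ((a : ℝ) + b) ^ A *
              Real.exp (-((c * (t ^ 2 * (F.scheme ℰp γ).β K / (((a : ℝ) + b) * (1 + Real.log ((a : ℝ) + b))))) ^ α)) := by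
  obtain ⟨c₀, hc₀, _, h⟩ := T3FinestHeightTail.gibbsMeasure_real_dist1_ge_le (N := 2)
  intro L R hR
  have hR0 : (0 : ℝ) < R := by exact_mod_cast hR
  refine ⟨1, 1 / (4 * (R : ℝ) ^ 4), 2 * Real.exp 24 * (c₀ ^ 3)⁻¹, 5, one_pos, by positivity, by positivity, ?_⟩
  intro F γ _ hγ hγ1 K a b x μ ν t hμν ha haR hb hbR _ ht _
  -- `β_K = (γ ε_K)⁻¹ ≥ 1` for `0 < γ ≤ 1`
  have hβ1 : 1 ≤ (F.scheme ℰp γ).β K := by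
    have hL1 : (1 : ℝ) ≤ (F.L : ℝ) := by exact_mod_cast F.hL.2.le
    have hLK : (1 : ℝ) ≤ (F.L : ℝ) ^ K := one_le_pow₀ hL1
    have hβ : (F.scheme ℰp γ).β K = (γ * ((F.L : ℝ)⁻¹) ^ K)⁻¹ := rfl
    rw [hβ, inv_pow]
    have hx0 : 0 < γ * ((F.L : ℝ) ^ K)⁻¹ := by positivity
    have hx1 : γ * ((F.L : ℝ) ^ K)⁻¹ ≤ 1 := by
      calc γ * ((F.L : ℝ) ^ K)⁻¹ ≤ 1 * 1 := by gcongr; exact inv_le_one_of_one_le₀ hLK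
        _ = 1 := one_mul 1
    exact one_le_inv_iff₀.mpr ⟨hx0, hx1⟩
  rw [gibbsK_eq]
  set β : ℝ := (F.scheme ℰp γ).β K with hβdef
  have hβ0 : 0 ≤ β := zero_le_one.trans hβ1
  haveI := T4GenFunBounds.isProbabilityMeasure_gibbsMeasure (G := Matrix.specialUnitaryGroup (Fin 2) ℂ) (F.P K) hβ0
  -- lattice Stokes + union bound
  obtain ⟨p, hsub⟩ := setOf_rectLoop_subset (G := Matrix.specialUnitaryGroup (Fin 2) ℂ) x hμν ha hb t
  have ha0 : (0 : ℝ) < a := by exact_mod_cast ha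
  have hb0 : (0 : ℝ) < b := by exact_mod_cast hb
  have htab : 0 ≤ t / (a * b) := div_nonneg ht.le (mul_pos ha0 hb0).le
  have hcard : Fintype.card {q : Fin (F.P K).d × Fin (F.P K).d // q.1 < q.2} = 3 := by
    rw [show (F.P K).d = 3 from rfl]; decide
  have hd3 : (F.P K).d = 3 := rfl
  have hterm : ∀ ik ∈ Finset.range a ×ˢ Finset.range b,
      (T4GenFunBounds.gibbsMeasure (F.P K) β).real
          {U : GaugeField (F.P K) 0 (Matrix.specialUnitaryGroup (Fin 2) ℂ) | t / (a * b) ≤ dist1 (GaugeField.plaqHol U (p ik))} ≤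
        2 * Real.exp 24 * (c₀ ^ 3)⁻¹ * Real.sqrt β ^ 9 * Real.exp (-(β * (t / (a * b)) ^ 2 / 4)) := by
    intro ik _
    have h1 := h (F.P K) β hβ1 (t / (a * b)) htab (p ik)
    rw [hcard, hd3] at h1
    have h8 : Real.exp (8 * (3 : ℕ)) = Real.exp 24 := by norm_num
    have h9 : 3 * (2 ^ 2 - 1) = 9 := by norm_num
    have h4 : (2 : ℝ) * ((2 : ℕ) : ℝ) = 4 := by norm_num
    rw [h8, h9, h4] at h1
    exact h1
  have hunion : (T4GenFunBounds.gibbsMeasure (F.P K) β).real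
        {U : GaugeField (F.P K) 0 (Matrix.specialUnitaryGroup (Fin 2) ℂ) | t ≤ dist1 (pathHol U (rectLoop x μ ν a b))} ≤
      ((a : ℝ) * b) * (2 * Real.exp 24 * (c₀ ^ 3)⁻¹ * Real.sqrt β ^ 9 * Real.exp (-(β * (t / (a * b)) ^ 2 / 4))) := by
    refine ((measureReal_mono hsub (measure_ne_top _ _)).trans (measureReal_biUnion_finset_le _ _)).trans ?_
    refine (Finset.sum_le_sum hterm).trans ?_
    rw [Finset.sum_const, Finset.card_product, Finset.card_range, Finset.card_range, nsmul_eq_mul, Nat.cast_mul]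
  refine hunion.trans ?_
  -- arithmetic
  have hsq : Real.sqrt β ^ 9 ≤ β ^ 5 := LargeFieldMassRefinementTail.sqrt_pow_nine_le_pow_five hβ1
  rw [Real.rpow_one]
  have ha1 : (1 : ℝ) ≤ a := by exact_mod_cast ha
  have hb1 : (1 : ℝ) ≤ b := by exact_mod_cast hb
  have haR' : (a : ℝ) ≤ R := by exact_mod_cast haR
  have hbR' : (b : ℝ) ≤ R := by exact_mod_cast hbR
  have hab2 : (2 : ℝ) ≤ a + b := by linarith
  have hlog : 0 ≤ Real.log ((a : ℝ) + b) := Real.log_nonneg (by linarith)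
  have hden : 0 < ((a : ℝ) + b) * (1 + Real.log ((a : ℝ) + b)) := by positivity
  -- exponent comparison: `(1/(4R⁴)) t²β/((a+b)(1+log(a+b))) ≤ β t²/(4a²b²)` since `a²b² ≤ R⁴ ≤ R⁴ (a+b)(1+log(a+b))`
  have hexp : Real.exp (-(β * (t / (a * b)) ^ 2 / 4)) ≤
      Real.exp (-(1 / (4 * (R : ℝ) ^ 4) * (t ^ 2 * β / (((a : ℝ) + b) * (1 + Real.log ((a : ℝ) + b)))))) := by
    rw [Real.exp_le_exp, neg_le_neg_iff]
    have hkey : ((a : ℝ) * b) ^ 2 ≤ (R : ℝ) ^ 4 * (((a : ℝ) + b) * (1 + Real.log ((a : ℝ) + b))) := by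
      have hab4 : ((a : ℝ) * b) ^ 2 ≤ (R : ℝ) ^ 4 := by
        have h1' : (a : ℝ) * b ≤ R * R := mul_le_mul haR' hbR' hb0.le hR0.le
        have h0' : 0 ≤ (a : ℝ) * b := by positivity
        calc ((a : ℝ) * b) ^ 2 ≤ ((R : ℝ) * R) ^ 2 := pow_le_pow_left₀ h0' h1' 2
          _ = (R : ℝ) ^ 4 := by ring
      have hD : (1 : ℝ) ≤ ((a : ℝ) + b) * (1 + Real.log ((a : ℝ) + b)) := by
        have h2 : (2 : ℝ) * 1 ≤ ((a : ℝ) + b) * (1 + Real.log ((a : ℝ) + b)) :=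
          mul_le_mul hab2 (by linarith) zero_le_one (by linarith)
        linarith
      calc ((a : ℝ) * b) ^ 2 ≤ (R : ℝ) ^ 4 := hab4
        _ = (R : ℝ) ^ 4 * 1 := by ring
        _ ≤ (R : ℝ) ^ 4 * (((a : ℝ) + b) * (1 + Real.log ((a : ℝ) + b))) := mul_le_mul_of_nonneg_left hD (by positivity)
    rw [div_pow]
    have ht2 : 0 ≤ t ^ 2 * β := by positivity
    calc 1 / (4 * (R : ℝ) ^ 4) * (t ^ 2 * β / (((a : ℝ) + b) * (1 + Real.log ((a : ℝ) + b))))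
        = t ^ 2 * β / (4 * ((R : ℝ) ^ 4 * (((a : ℝ) + b) * (1 + Real.log ((a : ℝ) + b))))) := by
          field_simp
      _ ≤ t ^ 2 * β / (4 * ((a : ℝ) * b) ^ 2) := by
          apply div_le_div_of_nonneg_left ht2 (by positivity)
          linarith [hkey]
      _ = β * (t ^ 2 / ((a : ℝ) * b) ^ 2) / 4 := by ring
  have hC : 0 ≤ 2 * Real.exp 24 * (c₀ ^ 3)⁻¹ := by positivity
  have habpow : (a : ℝ) * b ≤ ((a : ℝ) + b) ^ 5 := by
    have h2 : (a : ℝ) * b ≤ ((a : ℝ) + b) ^ 2 := by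
      rw [pow_two]
      nlinarith [mul_pos ha0 hb0, ha0, hb0]
    exact h2.trans (pow_le_pow_right₀ (by linarith) (by norm_num))
  calc (a : ℝ) * b * (2 * Real.exp 24 * (c₀ ^ 3)⁻¹ * Real.sqrt β ^ 9 * Real.exp (-(β * (t / (a * b)) ^ 2 / 4)))
      = 2 * Real.exp 24 * (c₀ ^ 3)⁻¹ * Real.sqrt β ^ 9 * ((a : ℝ) * b) * Real.exp (-(β * (t / (a * b)) ^ 2 / 4)) := by ring
    _ ≤ 2 * Real.exp 24 * (c₀ ^ 3)⁻¹ * β ^ 5 * ((a : ℝ) + b) ^ 5 *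
          Real.exp (-(1 / (4 * (R : ℝ) ^ 4) * (t ^ 2 * β / (((a : ℝ) + b) * (1 + Real.log ((a : ℝ) + b)))))) := by
        gcongr

end Summit.QuantumFields.YangMills.Theorems.RectangleDominationRectangleTailLBoundedRung
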